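import Summits.MatrixMultiplication.MatrixMultiplication.Theorems.AsymptoticRankCWBPerm3Form
import Summits.MatrixMultiplication.MatrixMultiplication.Theorems.AsymptoticRankCWGlueDet3Omega

/-!
# Line `skew-anchor` for the crux `BThesis` (stmt-MatrixMultiplication-0588) — transfer through the skew sibling

`BThesis` = `R̃(T_cw,2) = 3` in growth form (`R(T_cw,2^{⊗N}) = O(3^{(1+ε)N})`). LENS: transfer.

The anchor. Among the tensors supported on the six permutation cells of `[3]³` — the torus pencil
`T_ρ = P_even + ρ·P_odd` through `xyz ≅ T_cw,2` (`ρ = 1`) and the Levi-Civita tensor `ε ≅ T_skewcw,2`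
(`ρ = −1`) — the skew point `ε` is the one where FINITE Kronecker powers already show strict savings:
`bR(ε ⊠ ε) = bR(det₃) = 17 < 25 = bR(ε)²` (Conner–Gesmundo–Landsberg–Ventura 2022 Thm 1.3 / §1.3,
Conner–Huang–Landsberg 2020), whereas `bR(xyz ⊠ xyz) = bR(perm₃) = 16 = bR(xyz)²` is multiplicative.
Every finite invariant known orders the pair the same way: `R, bR: 4 < 5`, squares `16 < 17`, and all
quantum / support functionals agree (`= 3`, same tight support, flat marginals).

The line: (1) `stub_skewSquareNine` — `R̃(ε ⊠ ε) = 9`, VERBATIM the route's rank-3 crux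
`BDet3AsymptoticRank` (stmt-MatrixMultiplication-0591; it closes `ω = 2` on its own through the proved
`glueDet3Omega_proof`); (2) `stub_skewDominatesCw` — the skew sibling dominates the small
Coppersmith–Winograd tensor asymptotically, `R̃(T_cw,2) ≤ R̃(ε)` (NEW; fixes no value; the intended
mechanism is an asymptotic degeneration `ε^{⊠(N+o(N))} ⊵ T_cw,2^{⊠N}`, equivalently `F(T_cw,2) ≤ F(ε)` for
every universal spectral point — no GIT obstruction: both are polystable points of the Cartan subspace, so
only HONEST degenerations between them are excluded). Composition `BThesis_of` (kernel-checked): from (1),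
`R̃(ε) ≤ 3` by the proved growth lemma `isBigO_tensorRank_kroneckerPow_of_asymptoticRank_sq_le` and
`asymptoticRank_le_of_forall_isBigO`; with (2), `R̃(T_cw,2) ≤ 3`; the growth form is
`isBigO_of_asymptoticRank_le` (the inline power in `BThesis` is `kroneckerPow (cwTensor ℂ 2) N` by `rfl`).
-/

set_option linter.dupNamespace false

noncomputable section

namespace Summit.MatrixMultiplication.MatrixMultiplication.Cruxes.BThesis.SkewAnchor

open Literature.Computability.AlgebraicComplexity
open Summit.MatrixMultiplication.MatrixMultiplication.Theorems

/-- Local alias of the crux, used ONLY as the result type of the hypothesis-form `BThesis_of` (so that the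
hypothesis-free `BThesis_proof` below is the file's unique skeleton theorem concluding the route decl by name). -/
abbrev Goal : Prop := Summit.MatrixMultiplication.MatrixMultiplication.Theses.AsymptoticRankCW.BThesis

-- The Levi-Civita tensor `ε` on `Fin 3` is written INLINE below exactly as in the route's `BDet3AsymptoticRank`
-- (`ε(a,a+1,a+2) = 1`, `ε(a,a+2,a+1) = −1`; `≅ T_skewcw,2`, CGLV 2022 p. 7), so that stub signatures are self-contained.

/-- STUB 1 (= crux `BDet3AsymptoticRank`, stmt-MatrixMultiplication-0591, verbatim; open-problem):
`R̃(ε ⊠ ε) = R̃(det₃) = 9`. -/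
theorem stub_skewSquareNine : asymptoticRank (kroneckerTensor (fun a b c : Fin 3 => (if b = a + 1 ∧ c = a + 2 then (1 : ℂ) else 0) - (if b = a + 2 ∧ c = a + 1 then 1 else 0)) (fun a b c : Fin 3 => (if b = a + 1 ∧ c = a + 2 then (1 : ℂ) else 0) - (if b = a + 2 ∧ c = a + 1 then 1 else 0))) = 9 := by
  sorry

/-- STUB 2 (NEW content, size XL): the skew sibling dominates `T_cw,2` asymptotically. -/
theorem stub_skewDominatesCw : asymptoticRank (cwTensor ℂ 2) ≤ asymptoticRank (fun a b c : Fin 3 => (if b = a + 1 ∧ c = a + 2 then (1 : ℂ) else 0) - (if b = a + 2 ∧ c = a + 1 then 1 else 0)) := by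
  sorry

/-- COMPOSITION (kernel-checked, no sorry): skew ARC + domination ⇒ `BThesis` by name. -/
theorem BThesis_of (h₁ : asymptoticRank (kroneckerTensor (fun a b c : Fin 3 => (if b = a + 1 ∧ c = a + 2 then (1 : ℂ) else 0) - (if b = a + 2 ∧ c = a + 1 then 1 else 0)) (fun a b c : Fin 3 => (if b = a + 1 ∧ c = a + 2 then (1 : ℂ) else 0) - (if b = a + 2 ∧ c = a + 1 then 1 else 0))) = 9)
    (h₂ : asymptoticRank (cwTensor ℂ 2) ≤ asymptoticRank (fun a b c : Fin 3 => (if b = a + 1 ∧ c = a + 2 then (1 : ℂ) else 0) - (if b = a + 2 ∧ c = a + 1 then 1 else 0))) :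
    Goal := by
  unfold Goal Summit.MatrixMultiplication.MatrixMultiplication.Theses.AsymptoticRankCW.BThesis
  have h9 : asymptoticRank (kroneckerTensor (fun a b c : Fin 3 => (if b = a + 1 ∧ c = a + 2 then (1 : ℂ) else 0) - (if b = a + 2 ∧ c = a + 1 then 1 else 0)) (fun a b c : Fin 3 => (if b = a + 1 ∧ c = a + 2 then (1 : ℂ) else 0) - (if b = a + 2 ∧ c = a + 1 then 1 else 0))) ≤ (3 : ℝ) ^ 2 := by rw [h₁]; norm_num
  have hgrowth := isBigO_tensorRank_kroneckerPow_of_asymptoticRank_sq_le _ 3 (by norm_num) h9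
  have h3 : asymptoticRank (fun a b c : Fin 3 => (if b = a + 1 ∧ c = a + 2 then (1 : ℂ) else 0) - (if b = a + 2 ∧ c = a + 1 then 1 else 0)) ≤ 3 := asymptoticRank_le_of_forall_isBigO _ (by norm_num) hgrowth
  intro ε hε
  exact isBigO_of_asymptoticRank_le (cwTensor ℂ 2) (by norm_num) (h₂.trans h3) hε

/-- SKELETON THEOREM: the crux `BThesis` BY NAME from the declared stubs (sorries only inside `stub_*`). -/
theorem BThesis_proof : Summit.MatrixMultiplication.MatrixMultiplication.Theses.AsymptoticRankCW.BThesis :=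
  BThesis_of stub_skewSquareNine stub_skewDominatesCw

end Summit.MatrixMultiplication.MatrixMultiplication.Cruxes.BThesis.SkewAnchor

end
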